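import Mathlib
import Summits.ValiantsHypothesis.ValiantsHypothesis.Theorems.LacunarySymmetroidMatrixDescartesOneAlternation

/-!
# Tower graft line — the STEEP-ZONE LAW: an interval on which the Euler derivative of a symmetric matrix family is positive
# definite carries at most `m` determinant zeros; the definite far letter's steep zone is priced at `m`

Instrument/structure file for LINE (B) `Cruxes/WeakLifting/Lines/tower_graft.lean` (crux `WeakLifting` = stmt-ValiantsHypothesis-19561), memo
`tower_graft-S5.md` §3 T1 «log-slope localisation», rung S4 (GL-Id / GL-PD: graft of a DEFINITE far letter `X^D·P` on a class pencil
`G = Σ_l X^{d_l} S_l`).  The tree's T1 instrument prices two zones of `det (G + X^D·P)`: the BASE-dominant discs (matrix Rouché,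
`…TowerGraftOperatorRouche*`: crossings charged to `det G`) and the LETTER-dominant zone (`…OperatorRoucheLetterZone`: ROOT-FREE where `X^D·P`
row-dominates `G`).  This file adds the zone in between on the letter side:

§1 INTERVAL LOEWNER LAW (`SteepZone.card_le_of_posDef_increments`, abstract): a real symmetric family `H : ℝ → Matrix ι ι ℝ` with POSITIVE
   DEFINITE increments on `[a, b]` (`H t − H s ≻ 0` for `a ≤ s < t ≤ b`, `a > 0`) has at most `card ι` determinant zeros in `[a, b)` — the tree's
   inertia chain `stub_inertiaChain` (line `Lift`, 18050 side) applied to the CLAMPED family `u ↦ H (max a (min u b))`, which is Loewner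
   non-decreasing on all of `(0, ∞)`; half-line form `card_le_of_posDef_increments_Ici`.
§2 DERIVATIVE CRITERION (`posDef_increments_of_eulerDeriv`): for `H u = Σ_l u^{e_l}·T_l` (symmetric letters, natural exponents) positive
   definiteness of the EULER DERIVATIVE `θH (u) = Σ_l e_l u^{e_l}·T_l` on `[a, b]` gives positive definite increments there (mean value theorem on
   the quadratic forms `u ↦ vᵀH(u)v`, which are polynomial functions); so `θH ≻ 0` on `[a, b]` ⇒ at most `card ι` zeros of `det H` in `[a, b)`
   (`card_le_of_eulerDeriv_posDef`, `…_Ici`).  This is the matrix form of ONE Rolle step `#zeros ≤ #zeros of the derivative + 1` in the regime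
   where the derivative has none: the scalar case `card ι = 1` is «a K-nomial whose Euler derivative is positive on `J` has ≤ 1 zero on `J`».
§3 ROW-SUM CRITERION (`eulerDeriv_posDef_of_rowMargin`): if one letter `T_{l₀} ⪰ c·1` (`c > 0`) and at `u > 0`, for every row `i`,
   `Σ_{l ≠ l₀} e_l u^{e_l} · Σ_j |T_l i j| < e_{l₀} u^{e_{l₀}} · c`, then `θH (u) ≻ 0` (`|vᵀSv| ≤ Σ_i v_i² Σ_j |S_ij|` for symmetric `S`,
   `abs_quadForm_le_rowSum`).
§4 THE STEEP ZONE OF A DEFINITE GRAFT (`card_roots_Ici_definiteGraft_le`, `card_roots_Ici_identityGraft_le`): for `G = Σ_l X^{d_l} S_l`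
   (symmetric `m × m` letters) and `P ⪰ c·1`, on every half-line `[a, ∞)` along which `Σ_l d_l u^{d_l}·Σ_j|S_l i j| < D u^D·c` for every row
   `i`, `det (G + X^D·P)` has at most `m` zeros.  COMPARISON: the root-free letter zone of `…OperatorRoucheLetterZone` needs (row form)
   `Σ_l u^{d_l}·(row sums) < u^D·c`; the steep zone needs only the `d_l/D`-weighted sums, i.e. it begins where `u^D·c` exceeds
   `(max_l d_l / D)·Σ_l u^{d_l}·(row sums)` — a factor `D / max d > m` LOWER on a tower top (`m·d_l < D`) — and is priced at `m` roots, one per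
   eigenvalue branch.  READING FOR THE LINE (honest): with the Rouché discs (base side) and this law (letter side) both transitions of S4's
   T1 localisation are priced; the MIDDLE zone, where `u^D` is comparable to the small eigenvalues of `G(u)` but far below its row norm, is the
   research content of S4 and is NOT addressed here.  Zero stub credit.
HONEST FRAMING: classical (Loewner monotonicity / Rolle); nothing on S4/S4b/S5, TowerB, `WeakLifting`, Conjecture B, 18050 or VP ≠ VNP.  Def-free;
Mathlib + the tree's `…StubInertiaChain` / `…OneAlternation` (quadratic form of a family).  Seat: prover val-sym-lift-p2 g23,
`--supports stmt-ValiantsHypothesis-19561 --as helper`.  [folklore: Loewner/Weyl monotonicity, Rolle; the packaging for the line is this work]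
-/

-- `Summit.ValiantsHypothesis.ValiantsHypothesis.…` repeats a component by the D-0017 layout
-- (single-conjunct summit), which the `dupNamespace` linter flags; the name is mandated.
set_option linter.dupNamespace false
set_option autoImplicit false

namespace Summit.ValiantsHypothesis.ValiantsHypothesis.Theorems.KPlusLogSqLaw.TowerGraft

open Matrix Finset Polynomial
open scoped BigOperators
open Summit.ValiantsHypothesis.ValiantsHypothesis.Theorems.LacunarySymmetroidMatrixDescartes (stub_inertiaChain)
open Summit.ValiantsHypothesis.ValiantsHypothesis.Theorems.LacunarySymmetroidMatrixDescartes.OneAlternation (dotProduct_family_mulVec)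

namespace SteepZone

/-! ## §1 The interval Loewner law (abstract family, positive definite increments) -/

section Abstract

variable {ι : Type} [Fintype ι] [DecidableEq ι]

/-- **INTERVAL LOEWNER LAW.**  A real symmetric family `H` with positive definite increments on `[a, b]` (`a > 0`) has at most `card ι`
determinant zeros in `[a, b)`: the clamped family `u ↦ H (max a (min u b))` is Loewner non-decreasing on `(0, ∞)`, every zero carries a kernel
vector whose quadratic form is strictly positive at all later times, and the tree's inertia chain bounds such events by `card ι`. [folklore] -/
theorem card_le_of_posDef_increments (H : ℝ → Matrix ι ι ℝ) (hH : ∀ u, (H u).IsSymm) {a b : ℝ} (ha : 0 < a)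
    (hinc : ∀ s t : ℝ, a ≤ s → s < t → t ≤ b → (H t - H s).PosDef)
    (T : Finset ℝ) (hT : ∀ t ∈ T, a ≤ t ∧ t < b ∧ (H t).det = 0) : T.card ≤ Fintype.card ι := by
  classical
  -- the clamp and the clamped family
  let cl : ℝ → ℝ := fun u => max a (min u b)
  let G : ℝ → Matrix ι ι ℝ := fun u => H (cl u)
  have hcl_mono : ∀ s t : ℝ, s ≤ t → cl s ≤ cl t := fun s t hst =>
    max_le_max le_rfl (min_le_min hst le_rfl)
  have hcl_ge : ∀ u, a ≤ cl u := fun u => le_max_left _ _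
  have hcl_le : ∀ u, a < cl u → cl u ≤ b := by
    intro u hu
    have hlt : a < min u b := by
      rcases lt_max_iff.mp hu with h | h
      · exact absurd h (lt_irrefl _)
      · exact h
    have : cl u = min u b := max_eq_right hlt.le
    rw [this]
    exact min_le_right _ _
  have hcl_id : ∀ u, a ≤ u → u < b → cl u = u := by
    intro u hau hub
    show max a (min u b) = u
    rw [min_eq_left hub.le, max_eq_right hau]
  have hGsymm : ∀ s, (G s).IsSymm := fun s => hH _
  have hmono : ∀ s t : ℝ, 0 < s → s ≤ t → (G t - G s).PosSemidef := by
    intro s t _ hst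
    rcases (hcl_mono s t hst).eq_or_lt with h | h
    · have : G t = G s := by show H (cl t) = H (cl s); rw [h]
      rw [this, sub_self]
      exact Matrix.PosSemidef.zero
    · exact (hinc (cl s) (cl t) (hcl_ge s) h (hcl_le t (lt_of_le_of_lt (hcl_ge s) h))).posSemidef
  -- the chain of zeros, increasingly ordered, with kernel vectors
  let τ : Fin T.card ↪o ℝ := T.orderEmbOfFin rfl
  have hτmem : ∀ j, τ j ∈ T := fun j => T.orderEmbOfFin_mem rfl j
  have hτa : ∀ j, a ≤ τ j := fun j => (hT _ (hτmem j)).1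
  have hτb : ∀ j, τ j < b := fun j => (hT _ (hτmem j)).2.1
  have hτpos : ∀ j, 0 < τ j := fun j => lt_of_lt_of_le ha (hτa j)
  have hker' : ∀ j, ∃ v : ι → ℝ, v ≠ 0 ∧ H (τ j) *ᵥ v = 0 := fun j =>
    Matrix.exists_mulVec_eq_zero_iff.mpr (hT _ (hτmem j)).2.2
  choose v hv0 hker using hker'
  have hkerG : ∀ j, G (τ j) *ᵥ v j = 0 := by
    intro j
    show H (cl (τ j)) *ᵥ v j = 0
    rw [hcl_id _ (hτa j) (hτb j)]
    exact hker j
  have hposG : ∀ j (s : ℝ), τ j < s → 0 < v j ⬝ᵥ (G s *ᵥ v j) := by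
    intro j s hs
    -- `a ≤ τ j < cl s ≤ b`
    have hlt : τ j < cl s := lt_of_lt_of_le (lt_min hs (hτb j)) (le_max_right _ _)
    have hle : cl s ≤ b := hcl_le s (lt_of_le_of_lt (hτa j) hlt)
    have hpd := (hinc (τ j) (cl s) (hτa j) hlt hle).dotProduct_mulVec_pos (hv0 j)
    rw [star_trivial, Matrix.sub_mulVec, dotProduct_sub, hker j, dotProduct_zero, sub_zero] at hpd
    exact hpd
  exact stub_inertiaChain ι G hGsymm hmono T.card τ τ.strictMono hτpos v hkerG hposG

/-- half-line form: positive definite increments on `[a, ∞)` (`a > 0`) ⇒ at most `card ι` determinant zeros in `[a, ∞)`. [folklore] -/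
theorem card_le_of_posDef_increments_Ici (H : ℝ → Matrix ι ι ℝ) (hH : ∀ u, (H u).IsSymm) {a : ℝ} (ha : 0 < a)
    (hinc : ∀ s t : ℝ, a ≤ s → s < t → (H t - H s).PosDef)
    (T : Finset ℝ) (hT : ∀ t ∈ T, a ≤ t ∧ (H t).det = 0) : T.card ≤ Fintype.card ι := by
  refine card_le_of_posDef_increments H hH ha (b := (∑ t ∈ T, |t|) + 1) (fun s t hs hst _ => hinc s t hs hst) T
    fun t ht => ⟨(hT t ht).1, ?_, (hT t ht).2⟩
  calc t ≤ |t| := le_abs_self t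
    _ ≤ ∑ t' ∈ T, |t'| := Finset.single_le_sum (fun t' _ => abs_nonneg t') ht
    _ < (∑ t' ∈ T, |t'|) + 1 := lt_add_one _

end Abstract

/-! ## §2 The derivative criterion: `θH ≻ 0` on `[a, b]` ⇒ positive definite increments -/

section Euler

variable {ι : Type} [Fintype ι] [DecidableEq ι] {κ : Type} [Fintype κ]

/-- a scalar lacunary polynomial function whose Euler derivative `Σ_l e_l u^{e_l} q_l` is positive on `[a, b]` (`a > 0`) is strictly
increasing there (mean value theorem). [folklore] -/
theorem strictMonoOn_sum_pow_mul (e : κ → ℕ) (q : κ → ℝ) {a b : ℝ} (ha : 0 < a)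
    (h : ∀ u, a ≤ u → u ≤ b → 0 < ∑ l, (e l : ℝ) * u ^ e l * q l) :
    StrictMonoOn (fun u => ∑ l, u ^ e l * q l) (Set.Icc a b) := by
  classical
  let p : ℝ[X] := ∑ l, C (q l) * X ^ e l
  have hev : ∀ u, p.eval u = ∑ l, u ^ e l * q l := by
    intro u
    show (∑ l, C (q l) * X ^ e l).eval u = _
    rw [eval_finsetSum]
    exact Finset.sum_congr rfl fun l _ => by rw [eval_mul, eval_C, eval_pow, eval_X, mul_comm]
  have hder : ∀ u, u * (derivative p).eval u = ∑ l, (e l : ℝ) * u ^ e l * q l := by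
    intro u
    show u * (derivative (∑ l, C (q l) * X ^ e l)).eval u = _
    rw [derivative_sum, eval_finsetSum, Finset.mul_sum]
    refine Finset.sum_congr rfl fun l _ => ?_
    rw [derivative_C_mul, derivative_X_pow, eval_mul, eval_C, eval_mul, eval_C, eval_pow, eval_X]
    rcases Nat.eq_zero_or_pos (e l) with h0 | hpos
    · simp [h0]
    · have : u * u ^ (e l - 1) = u ^ e l := by
        rw [mul_comm]; exact pow_sub_one_mul (Nat.pos_iff_ne_zero.mp hpos) u
      calc u * (q l * ((e l : ℝ) * u ^ (e l - 1))) = (e l : ℝ) * (u * u ^ (e l - 1)) * q l := by ring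
        _ = (e l : ℝ) * u ^ e l * q l := by rw [this]
  have hmono : StrictMonoOn (fun u => p.eval u) (Set.Icc a b) := by
    refine strictMonoOn_of_deriv_pos (convex_Icc a b) (p.continuous.continuousOn) fun x hx => ?_
    rw [interior_Icc] at hx
    have hx0 : 0 < x := ha.trans hx.1
    rw [Polynomial.deriv]
    have h1 : 0 < x * (derivative p).eval x := by
      rw [hder]; exact h x hx.1.le hx.2.le
    exact (mul_pos_iff_of_pos_left hx0).mp h1
  intro s hs t ht hst
  have := hmono hs ht hst
  simp only [hev] at this
  exact this

omit [Fintype ι] [DecidableEq ι] in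
/-- the evaluated family `Σ_l c_l • T_l` is Hermitian (= symmetric over `ℝ`) when the letters are symmetric. [folklore] -/
theorem isHermitian_family (c : κ → ℝ) (Tm : κ → Matrix ι ι ℝ) (hTm : ∀ l, (Tm l).IsSymm) :
    (∑ l, c l • Tm l).IsHermitian := by
  unfold Matrix.IsHermitian
  rw [Matrix.conjTranspose_sum]
  refine Finset.sum_congr rfl fun l _ => ?_
  rw [Matrix.conjTranspose_smul, star_trivial, Matrix.conjTranspose_eq_transpose_of_trivial, (hTm l).eq]

omit [DecidableEq ι] in
/-- **DERIVATIVE CRITERION.**  For `H u = Σ_l u^{e_l} • T_l` with symmetric letters: if the Euler derivative `Σ_l (e_l u^{e_l}) • T_l` is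
positive definite for every `u ∈ [a, b]` (`a > 0`), then `H t − H s ≻ 0` for `a ≤ s < t ≤ b`. [folklore] -/
theorem posDef_increments_of_eulerDeriv (e : κ → ℕ) (Tm : κ → Matrix ι ι ℝ) (hTm : ∀ l, (Tm l).IsSymm) {a b : ℝ} (ha : 0 < a)
    (hθ : ∀ u, a ≤ u → u ≤ b → (∑ l, ((e l : ℝ) * u ^ e l) • Tm l).PosDef) :
    ∀ s t : ℝ, a ≤ s → s < t → t ≤ b → ((∑ l, (t ^ e l) • Tm l) - ∑ l, (s ^ e l) • Tm l).PosDef := by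
  intro s t hs hst htb
  refine Matrix.PosDef.of_dotProduct_mulVec_pos
    ((isHermitian_family _ Tm hTm).sub (isHermitian_family _ Tm hTm)) fun x hx => ?_
  rw [star_trivial, Matrix.sub_mulVec, dotProduct_sub, dotProduct_family_mulVec, dotProduct_family_mulVec]
  -- the quadratic form `u ↦ xᵀ H(u) x` is strictly increasing on `[a, b]`
  have hq : ∀ u, a ≤ u → u ≤ b → 0 < ∑ l, (e l : ℝ) * u ^ e l * (x ⬝ᵥ (Tm l *ᵥ x)) := by
    intro u hau hub
    have h1 := (hθ u hau hub).dotProduct_mulVec_pos hx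
    rwa [star_trivial, dotProduct_family_mulVec] at h1
  have hsm := strictMonoOn_sum_pow_mul e (fun l => x ⬝ᵥ (Tm l *ᵥ x)) ha hq
  have hlt := hsm ⟨hs, hst.le.trans htb⟩ ⟨hs.trans hst.le, htb⟩ hst
  exact sub_pos.mpr hlt

/-- **`θH ≻ 0` on `[a, b]` ⇒ at most `card ι` zeros of `det H` in `[a, b)`** (§1 + the derivative criterion). [folklore] -/
theorem card_le_of_eulerDeriv_posDef (e : κ → ℕ) (Tm : κ → Matrix ι ι ℝ) (hTm : ∀ l, (Tm l).IsSymm) {a b : ℝ} (ha : 0 < a)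
    (hθ : ∀ u, a ≤ u → u ≤ b → (∑ l, ((e l : ℝ) * u ^ e l) • Tm l).PosDef)
    (T : Finset ℝ) (hT : ∀ t ∈ T, a ≤ t ∧ t < b ∧ (∑ l, (t ^ e l) • Tm l).det = 0) : T.card ≤ Fintype.card ι :=
  card_le_of_posDef_increments (fun u => ∑ l, (u ^ e l) • Tm l)
    (fun u => by simpa using (isHermitian_family (fun l => u ^ e l) Tm hTm).eq ▸ (isHermitian_family (fun l => u ^ e l) Tm hTm))
    ha (posDef_increments_of_eulerDeriv e Tm hTm ha hθ) T hT

/-- half-line form: `θH ≻ 0` on `[a, ∞)` (`a > 0`) ⇒ at most `card ι` zeros of `det H` in `[a, ∞)`. [folklore] -/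
theorem card_le_of_eulerDeriv_posDef_Ici (e : κ → ℕ) (Tm : κ → Matrix ι ι ℝ) (hTm : ∀ l, (Tm l).IsSymm) {a : ℝ} (ha : 0 < a)
    (hθ : ∀ u, a ≤ u → (∑ l, ((e l : ℝ) * u ^ e l) • Tm l).PosDef)
    (T : Finset ℝ) (hT : ∀ t ∈ T, a ≤ t ∧ (∑ l, (t ^ e l) • Tm l).det = 0) : T.card ≤ Fintype.card ι :=
  card_le_of_posDef_increments_Ici (fun u => ∑ l, (u ^ e l) • Tm l)
    (fun u => by simpa using (isHermitian_family (fun l => u ^ e l) Tm hTm))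
    ha (fun s t hs hst => posDef_increments_of_eulerDeriv e Tm hTm ha (fun u hu _ => hθ u hu) s t hs hst le_rfl) T hT

end Euler

/-! ## §3 The row-sum criterion for `θH ≻ 0` when one letter is definite -/

section RowSum

variable {ι : Type} [Fintype ι] [DecidableEq ι] {κ : Type} [Fintype κ] [DecidableEq κ]

omit [DecidableEq ι] in
/-- **quadratic form vs. absolute row sums**: for a SYMMETRIC real matrix, `|vᵀ S v| ≤ Σ_i v_i² · Σ_j |S i j|` (from `2|v_i||v_j| ≤ v_i² + v_j²`
and the symmetry of `|S i j|`). [folklore] -/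
theorem abs_quadForm_le_rowSum (S : Matrix ι ι ℝ) (hS : S.IsSymm) (v : ι → ℝ) :
    |v ⬝ᵥ (S *ᵥ v)| ≤ ∑ i, v i ^ 2 * ∑ j, |S i j| := by
  have hexp : v ⬝ᵥ (S *ᵥ v) = ∑ i, ∑ j, v i * S i j * v j := by
    simp only [dotProduct, Matrix.mulVec, Finset.mul_sum]
    exact Finset.sum_congr rfl fun i _ => Finset.sum_congr rfl fun j _ => by ring
  rw [hexp]
  have h1 : |∑ i, ∑ j, v i * S i j * v j| ≤ ∑ i, ∑ j, |S i j| * (|v i| * |v j|) := by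
    refine (Finset.abs_sum_le_sum_abs _ _).trans (Finset.sum_le_sum fun i _ => ?_)
    refine (Finset.abs_sum_le_sum_abs _ _).trans (Finset.sum_le_sum fun j _ => ?_)
    rw [abs_mul, abs_mul]
    exact le_of_eq (by ring)
  have h2 : ∀ i j, |S i j| * (|v i| * |v j|) ≤ |S i j| * ((v i ^ 2 + v j ^ 2) / 2) := by
    intro i j
    refine mul_le_mul_of_nonneg_left ?_ (abs_nonneg _)
    have := two_mul_le_add_sq (|v i|) (|v j|)
    rw [sq_abs, sq_abs] at this
    linarith
  have h3 : (∑ i, ∑ j, |S i j| * ((v i ^ 2 + v j ^ 2) / 2)) =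
      (∑ i, ∑ j, |S i j| * v i ^ 2) / 2 + (∑ i, ∑ j, |S i j| * v j ^ 2) / 2 := by
    rw [Finset.sum_div, Finset.sum_div, ← Finset.sum_add_distrib]
    refine Finset.sum_congr rfl fun i _ => ?_
    rw [Finset.sum_div, Finset.sum_div, ← Finset.sum_add_distrib]
    exact Finset.sum_congr rfl fun j _ => by ring
  -- by symmetry the second double sum equals the first
  have h4 : (∑ i, ∑ j, |S i j| * v j ^ 2) = ∑ i, ∑ j, |S i j| * v i ^ 2 := by
    rw [Finset.sum_comm]
    exact Finset.sum_congr rfl fun i _ => Finset.sum_congr rfl fun j _ => by rw [← hS.apply j i]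
  have h5 : (∑ i, ∑ j, |S i j| * v i ^ 2) = ∑ i, v i ^ 2 * ∑ j, |S i j| := by
    refine Finset.sum_congr rfl fun i _ => ?_
    rw [Finset.mul_sum]
    exact Finset.sum_congr rfl fun j _ => by ring
  calc |∑ i, ∑ j, v i * S i j * v j| ≤ ∑ i, ∑ j, |S i j| * (|v i| * |v j|) := h1
    _ ≤ ∑ i, ∑ j, |S i j| * ((v i ^ 2 + v j ^ 2) / 2) :=
        Finset.sum_le_sum fun i _ => Finset.sum_le_sum fun j _ => h2 i j
    _ = ∑ i, v i ^ 2 * ∑ j, |S i j| := by rw [h3, h4, h5]; ring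

/-- a letter `P ⪰ c·1` has quadratic form `≥ c·‖v‖²`. [folklore] -/
theorem quadForm_ge_of_sub_smul_one_posSemidef (P : Matrix ι ι ℝ) {c : ℝ} (hP : (P - c • (1 : Matrix ι ι ℝ)).PosSemidef)
    (v : ι → ℝ) : c * ∑ i, v i ^ 2 ≤ v ⬝ᵥ (P *ᵥ v) := by
  classical
  have h := hP.dotProduct_mulVec_nonneg v
  rw [star_trivial, Matrix.sub_mulVec, dotProduct_sub, Matrix.smul_mulVec, Matrix.one_mulVec, dotProduct_smul,
    smul_eq_mul] at h
  have hvv : v ⬝ᵥ v = ∑ i, v i ^ 2 := by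
    simp only [dotProduct]; exact Finset.sum_congr rfl fun i _ => by ring
  rw [hvv] at h
  linarith

/-- **ROW-SUM CRITERION.**  Letters `T_l` symmetric, one of them `T_{l₀} ⪰ c·1` with `c > 0`; at a point `u > 0` where for every row `i`
`Σ_{l ≠ l₀} e_l u^{e_l} · Σ_j |T_l i j| < e_{l₀} u^{e_{l₀}} · c`, the Euler derivative `Σ_l (e_l u^{e_l}) • T_l` is positive definite.
[this work; Gershgorin-type] -/
theorem eulerDeriv_posDef_of_rowMargin (e : κ → ℕ) (Tm : κ → Matrix ι ι ℝ) (hTm : ∀ l, (Tm l).IsSymm) (l₀ : κ) {c u : ℝ}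
    (hP : (Tm l₀ - c • (1 : Matrix ι ι ℝ)).PosSemidef) (hu : 0 < u)
    (hrow : ∀ i, (∑ l ∈ univ.erase l₀, (e l : ℝ) * u ^ e l * ∑ j, |Tm l i j|) < (e l₀ : ℝ) * u ^ e l₀ * c) :
    (∑ l, ((e l : ℝ) * u ^ e l) • Tm l).PosDef := by
  classical
  refine Matrix.PosDef.of_dotProduct_mulVec_pos (isHermitian_family _ Tm hTm) fun x hx => ?_
  rw [star_trivial, dotProduct_family_mulVec]
  -- split off the definite letter
  rw [← Finset.add_sum_erase _ _ (Finset.mem_univ l₀)]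
  -- weights are nonnegative
  have hw : ∀ l, 0 ≤ (e l : ℝ) * u ^ e l := fun l => mul_nonneg (Nat.cast_nonneg _) (pow_nonneg hu.le _)
  -- the definite letter's form
  have h0 : (e l₀ : ℝ) * u ^ e l₀ * (c * ∑ i, x i ^ 2) ≤ (e l₀ : ℝ) * u ^ e l₀ * (x ⬝ᵥ (Tm l₀ *ᵥ x)) :=
    mul_le_mul_of_nonneg_left (quadForm_ge_of_sub_smul_one_posSemidef _ hP x) (hw l₀)
  -- the other letters' forms, bounded below by minus the row-sum bound
  have h1 : ∀ l, -((e l : ℝ) * u ^ e l * ∑ i, x i ^ 2 * ∑ j, |Tm l i j|) ≤ (e l : ℝ) * u ^ e l * (x ⬝ᵥ (Tm l *ᵥ x)) := by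
    intro l
    have hb := abs_quadForm_le_rowSum (Tm l) (hTm l) x
    have := neg_abs_le (x ⬝ᵥ (Tm l *ᵥ x))
    nlinarith [hw l]
  have h2 : -(∑ l ∈ univ.erase l₀, (e l : ℝ) * u ^ e l * ∑ i, x i ^ 2 * ∑ j, |Tm l i j|) ≤
      ∑ l ∈ univ.erase l₀, (e l : ℝ) * u ^ e l * (x ⬝ᵥ (Tm l *ᵥ x)) := by
    rw [← Finset.sum_neg_distrib]
    exact Finset.sum_le_sum fun l _ => h1 l
  -- rewrite the bound as a sum over rows and compare row by row
  have h3 : (∑ l ∈ univ.erase l₀, (e l : ℝ) * u ^ e l * ∑ i, x i ^ 2 * ∑ j, |Tm l i j|) =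
      ∑ i, x i ^ 2 * ∑ l ∈ univ.erase l₀, (e l : ℝ) * u ^ e l * ∑ j, |Tm l i j| := by
    simp only [Finset.mul_sum]
    rw [Finset.sum_comm]
    exact Finset.sum_congr rfl fun i _ => Finset.sum_congr rfl fun l _ => by ring
  have h4 : (e l₀ : ℝ) * u ^ e l₀ * (c * ∑ i, x i ^ 2) = ∑ i, x i ^ 2 * ((e l₀ : ℝ) * u ^ e l₀ * c) := by
    rw [Finset.mul_sum, Finset.mul_sum]
    exact Finset.sum_congr rfl fun i _ => by ring
  -- some coordinate of `x` is nonzero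
  obtain ⟨i₀, hi₀⟩ : ∃ i, x i ≠ 0 := by
    by_contra hne
    push Not at hne
    exact hx (funext hne)
  have h5 : (∑ i, x i ^ 2 * ∑ l ∈ univ.erase l₀, (e l : ℝ) * u ^ e l * ∑ j, |Tm l i j|) <
      ∑ i, x i ^ 2 * ((e l₀ : ℝ) * u ^ e l₀ * c) := by
    refine Finset.sum_lt_sum (fun i _ => mul_le_mul_of_nonneg_left (hrow i).le (sq_nonneg _))
      ⟨i₀, Finset.mem_univ _, ?_⟩
    exact mul_lt_mul_of_pos_left (hrow i₀) (by positivity)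
  linarith [h0, h2, h3, h4, h5]

end RowSum

/-! ## §4 The steep zone of a definite far-letter graft `G + X^D·P` -/

section Graft

variable {m K : ℕ}

/-- evaluation of the graft determinant at a real point: `det (G + X^D·P)(u) = det (Σ_l u^{(snoc d D) l} • (snoc S P) l)`. [folklore] -/
theorem eval_det_graft (D : ℕ) (d : Fin K → ℕ) (S : Fin K → Matrix (Fin m) (Fin m) ℝ) (P : Matrix (Fin m) (Fin m) ℝ) (u : ℝ) :
    (Matrix.det ((∑ l, ((X : ℝ[X]) ^ d l) • (S l).map C) + ((X : ℝ[X]) ^ D) • P.map C)).eval u =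
      Matrix.det (∑ l : Fin (K + 1), (u ^ (Fin.snoc d D : Fin (K + 1) → ℕ) l) • (Fin.snoc S P : Fin (K + 1) → _) l) := by
  rw [← Polynomial.coe_evalRingHom, RingHom.map_det, RingHom.mapMatrix_apply]
  congr 1
  ext i j
  rw [Fin.sum_univ_castSucc]
  simp only [Fin.snoc_castSucc, Fin.snoc_last, Matrix.map_apply, Matrix.add_apply, Matrix.sum_apply, Matrix.smul_apply,
    smul_eq_mul, Polynomial.coe_evalRingHom, eval_add, eval_finsetSum, eval_mul, eval_pow, eval_X, eval_C]

/-- **THE STEEP ZONE OF A DEFINITE GRAFT HOLDS AT MOST `m` ROOTS.**  `G = Σ_l X^{d_l} S_l` with symmetric `m × m` letters, far letter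
`P ⪰ c·1` (`c > 0`, `P` symmetric), `a > 0`; if along `[a, ∞)` every row satisfies `Σ_l d_l u^{d_l} · Σ_j |S_l i j| < D u^D · c`, then
`det (G + X^D·P)` has at most `m` zeros in `[a, ∞)` — one per eigenvalue branch (the family `G(u) + u^D P` has positive definite Euler
derivative there, §2–§3).  The root-free letter zone of `…OperatorRoucheLetterZone` starts a factor `≈ D / max d` higher. [this work] -/
theorem card_roots_Ici_definiteGraft_le (D : ℕ) (d : Fin K → ℕ) (S : Fin K → Matrix (Fin m) (Fin m) ℝ) (hS : ∀ l, (S l).IsSymm)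
    (P : Matrix (Fin m) (Fin m) ℝ) (hPs : P.IsSymm) {c a : ℝ} (hP : (P - c • (1 : Matrix (Fin m) (Fin m) ℝ)).PosSemidef) (ha : 0 < a)
    (hzone : ∀ u, a ≤ u → ∀ i, (∑ l, (d l : ℝ) * u ^ d l * ∑ j, |S l i j|) < (D : ℝ) * u ^ D * c) :
    ((Matrix.det ((∑ l, ((X : ℝ[X]) ^ d l) • (S l).map C) + ((X : ℝ[X]) ^ D) • P.map C)).roots.toFinset.filter
      (fun t => a ≤ t)).card ≤ m := by
  classical
  set f := Matrix.det ((∑ l, ((X : ℝ[X]) ^ d l) • (S l).map C) + ((X : ℝ[X]) ^ D) • P.map C) with hf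
  -- the snoc family
  let e : Fin (K + 1) → ℕ := Fin.snoc d D
  let Tm : Fin (K + 1) → Matrix (Fin m) (Fin m) ℝ := Fin.snoc S P
  have hTm : ∀ l, (Tm l).IsSymm := by
    intro l
    induction l using Fin.lastCases with
    | last => simpa [Tm] using hPs
    | cast l => simpa [Tm] using hS l
  have hθ : ∀ u, a ≤ u → (∑ l, ((e l : ℝ) * u ^ e l) • Tm l).PosDef := by
    intro u hu
    have hu0 : 0 < u := ha.trans_le hu
    refine eulerDeriv_posDef_of_rowMargin e Tm hTm (Fin.last K) (c := c) (by simpa [Tm] using hP) hu0 fun i => ?_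
    have hset : (univ.erase (Fin.last K) : Finset (Fin (K + 1))) = univ.map Fin.castSuccEmb := by
      ext l
      simp only [Finset.mem_erase, Finset.mem_univ, and_true, Finset.mem_map, Fin.castSuccEmb_apply, true_and]
      constructor
      · intro hl
        exact ⟨l.castPred hl, Fin.castSucc_castPred _ _⟩
      · rintro ⟨l', rfl⟩
        exact Fin.castSucc_ne_last l'
    rw [hset, Finset.sum_map]
    simpa [e, Tm] using hzone u hu i
  have hmain := card_le_of_eulerDeriv_posDef_Ici e Tm hTm ha hθ (f.roots.toFinset.filter fun t => a ≤ t) fun t ht => by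
    rw [Finset.mem_filter, Multiset.mem_toFinset] at ht
    refine ⟨ht.2, ?_⟩
    have hr := (Polynomial.mem_roots'.mp ht.1).2
    rw [Polynomial.IsRoot.def, hf, eval_det_graft] at hr
    exact hr
  simpa using hmain

/-- **THE STEEP ZONE OF THE IDENTITY GRAFT** (GL-Id's far letter): with `P = 1`, `c = 1`: if `Σ_l d_l u^{d_l}·Σ_j |S_l i j| < D u^D` for every
row along `[a, ∞)` (`a > 0`), then `det (G + X^D·1)` has at most `m` zeros in `[a, ∞)`. [this work] -/
theorem card_roots_Ici_identityGraft_le (D : ℕ) (d : Fin K → ℕ) (S : Fin K → Matrix (Fin m) (Fin m) ℝ) (hS : ∀ l, (S l).IsSymm)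
    {a : ℝ} (ha : 0 < a) (hzone : ∀ u, a ≤ u → ∀ i, (∑ l, (d l : ℝ) * u ^ d l * ∑ j, |S l i j|) < (D : ℝ) * u ^ D) :
    ((Matrix.det ((∑ l, ((X : ℝ[X]) ^ d l) • (S l).map C) +
        ((X : ℝ[X]) ^ D) • (1 : Matrix (Fin m) (Fin m) ℝ).map C)).roots.toFinset.filter (fun t => a ≤ t)).card ≤ m := by
  refine card_roots_Ici_definiteGraft_le D d S hS 1 Matrix.isSymm_one (c := 1) ?_ ha fun u hu i => by simpa using hzone u hu i
  rw [one_smul, sub_self]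
  exact Matrix.PosSemidef.zero

end Graft

end SteepZone

end Summit.ValiantsHypothesis.ValiantsHypothesis.Theorems.KPlusLogSqLaw.TowerGraft
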